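import Summits.AnomalousDissipation.AnomalousDissipation.Theorems.KolmogorovFloor.Negative.CheapBaseTools
import Summits.AnomalousDissipation.AnomalousDissipation.Theorems.SmoothEulerCoerciveForce.Negative.Cone
import Literature.Analysis.FunctionSpaces.TorusSpectralWeakDerivative
import Literature.Analysis.FunctionSpaces.TorusSobolevNormFacts

/-!
# Far-field dressing of an Euler shear: the algebra (negative side of `KolmogorovFloor`, stmt-14030)

cdisprove seat `refuter-cdisprove-stmt-AnomalousDissipation-14030-0` (2026-08-16). The kinematic heart of the
DRESSED LAMINAR RAY (Cruxes/KolmogorovFloor/DRESSED-RAY-r1-3.md §2 (a1)–(a6)): for an exact steady Euler state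
`U` (`(U·∇)U = 0`, work-free against `f`) dressed as `a = s•U + t•b` with `s t = 1`,

  `(a·∇)a − f = [(U·∇)b + (b·∇)U − f] + t² (b·∇)b`     (`farField_convect`),

so the steady-Euler defect of `a` is the LINEAR-RESPONSE defect of `b` plus `t²` times its self-advection, while
enstrophy, energy, slope and work of `a` are the obvious combinations (`toReal_eGradNormSq_farField_le`,
`integral_norm_sq_farField_le`, `slope_farField_le`, `work_farField`). Scaling facts: `eGradNormSq_const_smul`
(`‖∇(s•v)‖² = s²‖∇v‖²`, Fourier side), `fc_smul`, `fc_add`, `isDivFree_const_smul`, `hasZeroMean_const_smul`.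
Consumer: `Negative/FarFieldCheap.lean` (an approximate linear response makes CHEAP states).
-/

noncomputable section

open MeasureTheory UnitAddTorus Matrix
open scoped InnerProductSpace ENNReal ComplexConjugate

namespace Summit.AnomalousDissipation.AnomalousDissipation.Theorems.KolmogorovFloor.Negative

open Literature.Analysis.FunctionSpaces Literature.Analysis.FluidPDE
open Summit.AnomalousDissipation.AnomalousDissipation.Theorems.TaylorCertificatePair.Negative


/-! ### Fourier side of scaling and addition -/

/-- Complexification commutes with real scaling. -/
theorem complexify_comp_smul (s : ℝ) (v : (UnitAddTorus (Fin 3)) → (EuclideanSpace ℝ (Fin 3))) :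
    (EuclideanSpace.complexify ∘ (s • v)) = (s : ℂ) • (EuclideanSpace.complexify ∘ v) := by
  funext x
  simp only [Function.comp_apply, Pi.smul_apply, LinearIsometry.map_smul, Complex.coe_smul]

/-- `𝓕(s • v) = s • 𝓕v`. -/
theorem fc_smul (s : ℝ) (v : (UnitAddTorus (Fin 3)) → (EuclideanSpace ℝ (Fin 3))) (k : Fin 3 → ℤ) :
    mFourierCoeff (EuclideanSpace.complexify ∘ (s • v)) k = (s : ℂ) • mFourierCoeff (EuclideanSpace.complexify ∘ v) k := by
  rw [complexify_comp_smul, Torus.mFourierCoeff_const_smul]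

/-- `𝓕(u + v) = 𝓕u + 𝓕v` for integrable fields. -/
theorem fc_add {u v : (UnitAddTorus (Fin 3)) → (EuclideanSpace ℝ (Fin 3))} (hu : Integrable u volume) (hv : Integrable v volume) (k : Fin 3 → ℤ) :
    mFourierCoeff (EuclideanSpace.complexify ∘ (u + v)) k =
      mFourierCoeff (EuclideanSpace.complexify ∘ u) k + mFourierCoeff (EuclideanSpace.complexify ∘ v) k := by
  have h : (EuclideanSpace.complexify ∘ (u + v)) = (EuclideanSpace.complexify ∘ u) + (EuclideanSpace.complexify ∘ v) := by
    funext x; simp only [Function.comp_apply, Pi.add_apply, map_add]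
  rw [h, Torus.mFourierCoeff_add (Torus.integrable_complexify_comp hu) (Torus.integrable_complexify_comp hv)]

/-- **Scaling of the spectral enstrophy**: `‖∇(s • v)‖² = s² ‖∇v‖²`. -/
theorem eGradNormSq_const_smul (s : ℝ) (v : (UnitAddTorus (Fin 3)) → (EuclideanSpace ℝ (Fin 3))) :
    Torus.eGradNormSq (s • v) = ENNReal.ofReal (s ^ 2) * Torus.eGradNormSq v := by
  rw [Torus.eGradNormSq_eq_tsum, Torus.eGradNormSq_eq_tsum]
  have hterm : ∀ k : Fin 3 → ℤ, ENNReal.ofReal (Torus.freqNormSq k) *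
      ‖mFourierCoeff (EuclideanSpace.complexify ∘ (s • v)) k‖ₑ ^ 2 =
        ENNReal.ofReal (s ^ 2) * (ENNReal.ofReal (Torus.freqNormSq k) *
          ‖mFourierCoeff (EuclideanSpace.complexify ∘ v) k‖ₑ ^ 2) := by
    intro k
    rw [fc_smul, enorm_smul, mul_pow]
    have : ‖(s : ℂ)‖ₑ ^ 2 = ENNReal.ofReal (s ^ 2) := by
      rw [← ofReal_norm, Complex.norm_real,
        Real.norm_eq_abs, ← ENNReal.ofReal_pow (abs_nonneg s), sq_abs]
    rw [this]; ring
  simp_rw [hterm]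
  rw [ENNReal.tsum_mul_left]; ring

/-- `toReal` form: `‖∇(s • v)‖² = s² ‖∇v‖²`. -/
theorem toReal_eGradNormSq_const_smul (s : ℝ) (v : (UnitAddTorus (Fin 3)) → (EuclideanSpace ℝ (Fin 3))) :
    (Torus.eGradNormSq (s • v)).toReal = s ^ 2 * (Torus.eGradNormSq v).toReal := by
  rw [eGradNormSq_const_smul, ENNReal.toReal_mul, ENNReal.toReal_ofReal (sq_nonneg s)]

/-- Scaling preserves solenoidality (smooth fields). -/
theorem isDivFree_const_smul {v : (UnitAddTorus (Fin 3)) → (EuclideanSpace ℝ (Fin 3))} (hv : Torus.IsSmooth v) (hd : Torus.IsDivFree v) (c : ℝ) :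
    Torus.IsDivFree (c • v) := fun x => by
  rw [Summit.AnomalousDissipation.AnomalousDissipation.Theorems.SmoothEulerCoerciveForce.Negative.divergence_const_smul hv c x,
    hd x, mul_zero]

/-- Scaling preserves zero mean. -/
theorem hasZeroMean_const_smul {v : (UnitAddTorus (Fin 3)) → (EuclideanSpace ℝ (Fin 3))} (hz : Torus.HasZeroMean v) (c : ℝ) : Torus.HasZeroMean (c • v) := by
  unfold Torus.HasZeroMean at hz ⊢
  simp only [Pi.smul_apply, integral_smul, hz, smul_zero]

/-! ### The dressed state `a = s•U + t•b` -/

/-- Regularity of the dressed state. -/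
theorem farField_regular {U b : (UnitAddTorus (Fin 3)) → (EuclideanSpace ℝ (Fin 3))} (hU : Torus.IsSmooth U) (hUd : Torus.IsDivFree U) (hUz : Torus.HasZeroMean U)
    (hb : Torus.IsSmooth b) (hbd : Torus.IsDivFree b) (hbz : Torus.HasZeroMean b) (s t : ℝ) :
    Torus.IsSmooth (s • U + t • b) ∧ Torus.IsDivFree (s • U + t • b) ∧ Torus.HasZeroMean (s • U + t • b) := by
  refine ⟨(hU.smul s).add (hb.smul t), ?_, ?_⟩
  · exact Torus.IsDivFree.add ((hU.smul s).isContDiff (by simp)) ((hb.smul t).isContDiff (by simp))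
      (isDivFree_const_smul hU hUd s) (isDivFree_const_smul hb hbd t)
  · exact Torus.HasZeroMean.add (hasZeroMean_const_smul hUz s) (hasZeroMean_const_smul hbz t)
      (hU.smul s).integrable (hb.smul t).integrable

/-- **The residual identity of the dressed ray** (`(U·∇)U = 0`, `s t = 1`):
`(a·∇)a = [(U·∇)b + (b·∇)U] + t²(b·∇)b`. -/
theorem farField_convect {U b : (UnitAddTorus (Fin 3)) → (EuclideanSpace ℝ (Fin 3))} (hU : Torus.IsSmooth U) (hb : Torus.IsSmooth b)
    (hUU : ∀ x, Torus.convect U U x = 0) {s t : ℝ} (hst : s * t = 1) (x : (UnitAddTorus (Fin 3))) :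
    Torus.convect (s • U + t • b) (s • U + t • b) x =
      (Torus.convect U b x + Torus.convect b U x) + (t ^ 2) • Torus.convect b b x := by
  have hU1 : Torus.IsContDiff 1 U := hU.isContDiff (by simp)
  have hb1 : Torus.IsContDiff 1 b := hb.isContDiff (by simp)
  have hsU1 : Torus.IsContDiff 1 (s • U) := (hU.smul s).isContDiff (by simp)
  have htb1 : Torus.IsContDiff 1 (t • b) := (hb.smul t).isContDiff (by simp)
  have e1 : Torus.convect (s • U + t • b) (s • U + t • b) x =
      Torus.convect (s • U) (s • U + t • b) x + Torus.convect (t • b) (s • U + t • b) x :=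
    Torus.convect_add_left (s • U) (t • b) _ x
  have e2 : ∀ w : (UnitAddTorus (Fin 3)) → (EuclideanSpace ℝ (Fin 3)), Torus.convect w (s • U + t • b) x = Torus.convect w (s • U) x + Torus.convect w (t • b) x :=
    fun w => Torus.convect_add_right w hsU1 htb1 x
  have e3 : ∀ (w v : (UnitAddTorus (Fin 3)) → (EuclideanSpace ℝ (Fin 3))) (c : ℝ), Torus.IsContDiff 1 v → Torus.convect w (c • v) x = c • Torus.convect w v x :=
    fun w v c hv => Torus.convect_smul_right w hv c x
  have e4 : ∀ (w v : (UnitAddTorus (Fin 3)) → (EuclideanSpace ℝ (Fin 3))) (c : ℝ), Torus.convect (c • w) v x = c • Torus.convect w v x :=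
    fun w v c => Torus.convect_smul_left c w v x
  rw [e1, e2, e2, e3 _ _ _ hU1, e3 _ _ _ hb1, e3 _ _ _ hU1, e3 _ _ _ hb1, e4, e4, e4, e4, hUU x, smul_zero,
    smul_zero, zero_add, smul_smul, smul_smul, smul_smul, mul_comm t s, hst, one_smul, one_smul, sq, ← add_assoc]

/-- The steady-Euler defect pairing of the dressed state. -/
theorem farField_defect {U b f W : (UnitAddTorus (Fin 3)) → (EuclideanSpace ℝ (Fin 3))} (hU : Torus.IsSmooth U) (hb : Torus.IsSmooth b) (hf : Torus.IsSmooth f)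
    (hW : Torus.IsSmooth W) (hUU : ∀ x, Torus.convect U U x = 0) {s t : ℝ} (hst : s * t = 1) :
    ∫ x, ⟪Torus.convect (s • U + t • b) (s • U + t • b) x - f x, W x⟫_ℝ =
      (∫ x, ⟪Torus.convect U b x + Torus.convect b U x - f x, W x⟫_ℝ) + t ^ 2 * ∫ x, ⟪Torus.convect b b x, W x⟫_ℝ := by
  have h1 : Integrable (fun x => ⟪Torus.convect U b x + Torus.convect b U x - f x, W x⟫_ℝ) volume :=
    ((((hU.convect hb).add (hb.convect hU)).sub hf).inner hW).integrable
  have h2 : Integrable (fun x => ⟪Torus.convect b b x, W x⟫_ℝ) volume := ((hb.convect hb).inner hW).integrable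
  rw [← integral_const_mul, ← integral_add h1 (h2.const_mul _)]
  refine integral_congr_ae (ae_of_all _ fun x => ?_)
  dsimp only
  rw [farField_convect hU hb hUU hst x]
  simp only [inner_add_left, inner_sub_left, inner_smul_left, conj_trivial]
  ring

/-- Enstrophy of the dressed state: `‖∇a‖² ≤ 2s²‖∇U‖² + 2t²‖∇b‖²`. -/
theorem toReal_eGradNormSq_farField_le {U b : (UnitAddTorus (Fin 3)) → (EuclideanSpace ℝ (Fin 3))} (hU : Torus.IsSmooth U) (hb : Torus.IsSmooth b) (s t : ℝ) :
    (Torus.eGradNormSq (s • U + t • b)).toReal ≤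
      2 * s ^ 2 * (Torus.eGradNormSq U).toReal + 2 * t ^ 2 * (Torus.eGradNormSq b).toReal := by
  have e : s • U + t • b = s • U - (-t) • b := by rw [neg_smul, sub_neg_eq_add]
  rw [e]
  have h1 := Literature.Analysis.FluidPDE.Torus.eGradNormSq_sub_le (hU.smul s).integrable (hb.smul (-t)).integrable
  have hfinU : Torus.eGradNormSq (s • U) ≠ ⊤ :=
    Summit.AnomalousDissipation.AnomalousDissipation.Theorems.FloorCertificate.Negative.eGradNormSq_ne_top_of_smooth (hU.smul s)
  have hfinb : Torus.eGradNormSq ((-t) • b) ≠ ⊤ :=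
    Summit.AnomalousDissipation.AnomalousDissipation.Theorems.FloorCertificate.Negative.eGradNormSq_ne_top_of_smooth (hb.smul (-t))
  have hfin : 2 * Torus.eGradNormSq (s • U) + 2 * Torus.eGradNormSq ((-t) • b) ≠ ⊤ :=
    ENNReal.add_ne_top.2 ⟨ENNReal.mul_ne_top (by simp) hfinU, ENNReal.mul_ne_top (by simp) hfinb⟩
  have h2 := ENNReal.toReal_mono hfin h1
  rw [ENNReal.toReal_add (ENNReal.mul_ne_top (by simp) hfinU) (ENNReal.mul_ne_top (by simp) hfinb),
    ENNReal.toReal_mul, ENNReal.toReal_mul, toReal_eGradNormSq_const_smul, toReal_eGradNormSq_const_smul] at h2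
  simp only [ENNReal.toReal_ofNat] at h2
  have e2 : (-t) ^ 2 = t ^ 2 := by ring
  rw [e2] at h2
  linarith

/-- Energy of the dressed state: `∫‖a‖² ≤ 2s²∫‖U‖² + 2t²∫‖b‖²`. -/
theorem integral_norm_sq_farField_le {U b : (UnitAddTorus (Fin 3)) → (EuclideanSpace ℝ (Fin 3))} (hU : Torus.IsSmooth U) (hb : Torus.IsSmooth b) (s t : ℝ) :
    ∫ x, ‖(s • U + t • b) x‖ ^ 2 ≤ 2 * s ^ 2 * (∫ x, ‖U x‖ ^ 2) + 2 * t ^ 2 * ∫ x, ‖b x‖ ^ 2 := by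
  have h := integral_norm_sq_add_le (hU.smul s) (hb.smul t)
  have e1 : ∫ x, ‖(s • U) x‖ ^ 2 = s ^ 2 * ∫ x, ‖U x‖ ^ 2 := by
    rw [← integral_const_mul]
    refine integral_congr_ae (ae_of_all _ fun x => ?_)
    simp only [Pi.smul_apply, norm_smul, mul_pow, Real.norm_eq_abs, sq_abs]
  have e2 : ∫ x, ‖(t • b) x‖ ^ 2 = t ^ 2 * ∫ x, ‖b x‖ ^ 2 := by
    rw [← integral_const_mul]
    refine integral_congr_ae (ae_of_all _ fun x => ?_)
    simp only [Pi.smul_apply, norm_smul, mul_pow, Real.norm_eq_abs, sq_abs]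
  rw [e1, e2] at h
  linarith

/-- Slope of the dressed state over a ball: `Σ|k|‖â(k)‖ ≤ |s|Σ|k|‖Û(k)‖ + |t|Σ|k|‖b̂(k)‖`. -/
theorem slope_farField_le {U b : (UnitAddTorus (Fin 3)) → (EuclideanSpace ℝ (Fin 3))} (hU : Torus.IsSmooth U) (hb : Torus.IsSmooth b) (s t : ℝ) (N : ℕ) :
    ∑ κ ∈ Torus.freqBall N, Real.sqrt (Torus.freqNormSq κ) * ‖mFourierCoeff (EuclideanSpace.complexify ∘ (s • U + t • b)) κ‖ ≤
      |s| * ∑ κ ∈ Torus.freqBall N, Real.sqrt (Torus.freqNormSq κ) * ‖mFourierCoeff (EuclideanSpace.complexify ∘ U) κ‖ +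
      |t| * ∑ κ ∈ Torus.freqBall N, Real.sqrt (Torus.freqNormSq κ) * ‖mFourierCoeff (EuclideanSpace.complexify ∘ b) κ‖ := by
  rw [Finset.mul_sum, Finset.mul_sum, ← Finset.sum_add_distrib]
  refine Finset.sum_le_sum fun κ _ => ?_
  rw [fc_add (hU.smul s).integrable (hb.smul t).integrable, fc_smul, fc_smul]
  have h := norm_add_le ((s : ℂ) • mFourierCoeff (EuclideanSpace.complexify ∘ U) κ) ((t : ℂ) • mFourierCoeff (EuclideanSpace.complexify ∘ b) κ)
  rw [norm_smul, norm_smul, Complex.norm_real, Complex.norm_real, Real.norm_eq_abs, Real.norm_eq_abs] at h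
  have h0 : 0 ≤ Real.sqrt (Torus.freqNormSq κ) := Real.sqrt_nonneg _
  have := mul_le_mul_of_nonneg_left h h0
  linarith only [this]

/-- Work of the dressed state: `(a, f) = t (b, f)` when `(U, f) = 0`. -/
theorem work_farField {U b f : (UnitAddTorus (Fin 3)) → (EuclideanSpace ℝ (Fin 3))} (hU : Torus.IsSmooth U) (hb : Torus.IsSmooth b) (hf : Torus.IsSmooth f)
    (hUf : ∫ x, ⟪U x, f x⟫_ℝ = 0) (s t : ℝ) :
    ∫ x, ⟪(s • U + t • b) x, f x⟫_ℝ = t * ∫ x, ⟪b x, f x⟫_ℝ := by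
  have h1 : Integrable (fun x => ⟪U x, f x⟫_ℝ) volume := (hU.inner hf).integrable
  have h2 : Integrable (fun x => ⟪b x, f x⟫_ℝ) volume := (hb.inner hf).integrable
  have e : (fun x => ⟪(s • U + t • b) x, f x⟫_ℝ) = fun x => s * ⟪U x, f x⟫_ℝ + t * ⟪b x, f x⟫_ℝ := by
    funext x
    simp only [Pi.add_apply, Pi.smul_apply, inner_add_left, inner_smul_left, conj_trivial]
  rw [e, integral_add (h1.const_mul s) (h2.const_mul t), integral_const_mul, integral_const_mul, hUf, mul_zero, zero_add]

end Summit.AnomalousDissipation.AnomalousDissipation.Theorems.KolmogorovFloor.Negative
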